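import Summits.ABC.ABC.Theorems.LogCardinalitySubPowerStewartYuAnalysis
import HarnessLib

/-!
# Sub-power Stewart–Yu (crux `SubPowerStewartYu`, stmt-ABC-11053), VI: Stewart's parameters

`Summits/ABC/ABC/Theorems/LogCardinalitySubPowerStewartYuParams.lean` — helper file toward
`Summit.ABC.ABC.Theses.LogCardinality.SubPowerStewartYu`: the absorptions (i)–(iv) required by
`numeric_core`, for Stewart's choice `k = ⌊log p / (C₂ log log p)⌋` with `C₂ = 64 Ā² e⁴`,
auxiliary primes of logarithmic size `m = 4 log log R`, and `log R / 4 ≤ log p ≤ log R`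
[cite: Stewart2013, proof of Lemma 8, (28)–(29) and (38) (arXiv pp. 9–10)]. Pure real analysis.
No new definitions.
-/

noncomputable section

-- `Summit.ABC.ABC.…` is the tree's namespace convention for this sub-problem (summit = problem).
set_option linter.dupNamespace false

open Finset Real

namespace Summit.ABC.ABC.Theorems.SubPowerSY

/-- **Stewart's parameters satisfy the absorptions of `numeric_core`.** With `Ā ≥ 1`,
`C₂ = 64 Ā² e⁴`, `L ≥ 16`, `L/4 ≤ Ls ≤ L` (`Ls = log p`), `ℓ = log L`, `x = Ls/(C₂ log Ls)`,
`k = ⌊x⌋ ≥ 2`, `m = 4ℓ`, and the largeness conditions `8 C₂ (log Ls)² ≤ Ls`,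
`6 + log Ls ≤ Ls/1000`:  `8Ā² k m ≤ e⁻⁴ Ls`, `2k ≤ Ls`, `8k³Ls ≤ e^k`,
`4k³Ls² (4Ā²e²m)^k ≤ e^{Ls − 4k}` and `3k ≤ Ls/8`.
[cite: Stewart2013, proof of Lemma 8, (28)–(29), (38) (arXiv pp. 9–10)] -/
theorem stewart_param_bounds {Ab C₂ L Ls ℓ x m : ℝ} {k : ℕ} (hAb1 : 1 ≤ Ab)
    (hC₂ : C₂ = 64 * Ab ^ 2 * Real.exp 4) (hL16 : 16 ≤ L) (hLp : L / 4 ≤ Ls) (hpL : Ls ≤ L)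
    (hℓ : ℓ = Real.log L) (hx : x = Ls / (C₂ * Real.log Ls)) (hkx : (k : ℝ) ≤ x)
    (hxk : x < k + 1) (hk2 : 2 ≤ k) (hm : m = 4 * ℓ)
    (hc2 : 8 * C₂ * Real.log Ls ^ 2 ≤ Ls) (hc3 : 6 + Real.log Ls ≤ 0.001 * Ls) :
    8 * Ab ^ 2 * (k : ℝ) * m ≤ Real.exp (-4) * Ls ∧ 2 * (k : ℝ) ≤ Ls ∧
      8 * (k : ℝ) ^ 3 * Ls ≤ Real.exp (k : ℝ) ∧
      4 * (k : ℝ) ^ 3 * Ls ^ 2 * (4 * Ab ^ 2 * Real.exp 2 * m) ^ k ≤ Real.exp (Ls - 4 * (k : ℝ)) ∧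
      3 * (k : ℝ) ≤ Ls / 8 := by
  -- constants
  have hAbpos : 0 < Ab := by linarith
  have he1 : (2.7182818283 : ℝ) < Real.exp 1 := Real.exp_one_gt_d9
  have he4 : (54 : ℝ) ≤ Real.exp 4 := by
    have h : Real.exp 4 = Real.exp 1 ^ 4 := by rw [← Real.exp_nat_mul]; norm_num
    rw [h]; nlinarith [pow_le_pow_left₀ (by norm_num : (0:ℝ) ≤ 2.7182818283) he1.le 4]
  have hAb2 : 1 ≤ Ab ^ 2 := one_le_pow₀ hAb1
  have hC₂ge : 3456 ≤ C₂ := by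
    rw [hC₂]
    calc (3456 : ℝ) = 64 * 1 * 54 := by norm_num
      _ ≤ 64 * Ab ^ 2 * Real.exp 4 := mul_le_mul (mul_le_mul_of_nonneg_left hAb2 (by norm_num)) he4
          (by norm_num) (by positivity)
  have hC₂pos : 0 < C₂ := by linarith
  -- logarithms
  have hLpos : 0 < L := by linarith
  have hLs4 : 4 ≤ Ls := by linarith
  have hLspos : 0 < Ls := by linarith
  have hlog2 : (0.6931471803 : ℝ) < Real.log 2 := Real.log_two_gt_d9
  have hlog2' : Real.log 2 < 0.6931471808 := Real.log_two_lt_d9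
  have hlog4eq : Real.log 4 = 2 * Real.log 2 := by
    rw [show (4 : ℝ) = 2 ^ 2 by norm_num, Real.log_pow]; push_cast; ring
  have hlog16eq : Real.log 16 = 4 * Real.log 2 := by
    rw [show (16 : ℝ) = 2 ^ 4 by norm_num, Real.log_pow]; push_cast; ring
  have hℓ16 : Real.log 16 ≤ ℓ := by rw [hℓ]; exact Real.log_le_log (by norm_num) hL16
  have hℓ276 : 2.76 ≤ ℓ := by rw [hlog16eq] at hℓ16; linarith
  have hℓpos : 0 < ℓ := by linarith
  have hlogLs1 : Real.log 4 ≤ Real.log Ls := Real.log_le_log (by norm_num) hLs4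
  have hlogLs1' : 1 ≤ Real.log Ls := by rw [hlog4eq] at hlogLs1; linarith
  have hlogLspos : 0 < Real.log Ls := by linarith
  have hlogLsℓ : Real.log Ls ≤ ℓ := by rw [hℓ]; exact Real.log_le_log hLspos hpL
  have hlogLsℓ4 : ℓ - 2 * Real.log 2 ≤ Real.log Ls := by
    have h1 : Real.log (L / 4) ≤ Real.log Ls := Real.log_le_log (by positivity) hLp
    rw [Real.log_div hLpos.ne' (by norm_num), hlog4eq, ← hℓ] at h1
    exact h1
  have hlogLshalf : ℓ / 2 ≤ Real.log Ls := by linarith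
  -- `x` and `k`
  have hxpos : 0 < x := by rw [hx]; positivity
  have hxup : x ≤ Ls / C₂ := by
    rw [hx]; apply div_le_div_of_nonneg_left hLspos.le hC₂pos
    exact le_mul_of_one_le_right hC₂pos.le hlogLs1'
  have hxLs8 : x ≤ Ls / 32 := by
    have : Ls / C₂ ≤ Ls / 32 := div_le_div_of_nonneg_left hLspos.le (by norm_num) (by linarith)
    linarith
  have hk2r : (2 : ℝ) ≤ k := by exact_mod_cast hk2
  have hkLs : (k : ℝ) ≤ Ls := hkx.trans (hxup.trans (div_le_self hLspos.le (by linarith)))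
  have hm1 : 1 ≤ m := by rw [hm]; linarith
  -- (i)  `8 Ā² k m ≤ e⁻⁴ Ls`
  have hkm : (k : ℝ) * m ≤ 8 * Ls / C₂ := by
    calc (k : ℝ) * m ≤ x * m := mul_le_mul_of_nonneg_right hkx (by linarith)
      _ = Ls / (C₂ * Real.log Ls) * (4 * ℓ) := by rw [hm, hx]
      _ ≤ Ls / (C₂ * (ℓ / 2)) * (4 * ℓ) := by
          apply mul_le_mul_of_nonneg_right _ (by linarith)
          exact div_le_div_of_nonneg_left hLspos.le (by positivity)
            (mul_le_mul_of_nonneg_left hlogLshalf hC₂pos.le)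
      _ = 8 * Ls / C₂ := by field_simp; ring
  have hi : 8 * Ab ^ 2 * (k : ℝ) * m ≤ Real.exp (-4) * Ls := by
    have h64 : (64 : ℝ) * Ab ^ 2 ≠ 0 := mul_ne_zero (by norm_num) (pow_ne_zero 2 hAbpos.ne')
    have h1 : 8 * Ab ^ 2 * (k : ℝ) * m ≤ 64 * Ab ^ 2 * Ls / C₂ := by
      have h0 := mul_le_mul_of_nonneg_left hkm (show (0 : ℝ) ≤ 8 * Ab ^ 2 by positivity)
      calc 8 * Ab ^ 2 * (k : ℝ) * m = 8 * Ab ^ 2 * ((k : ℝ) * m) := by ring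
        _ ≤ 8 * Ab ^ 2 * (8 * Ls / C₂) := h0
        _ = 64 * Ab ^ 2 * Ls / C₂ := by ring
    have h2 : 64 * Ab ^ 2 * Ls / C₂ = Real.exp (-4) * Ls := by
      rw [hC₂, mul_div_mul_left Ls (Real.exp 4) h64, Real.exp_neg, div_eq_mul_inv, mul_comm]
    linarith
  -- (iv) `2k ≤ Ls`
  have hkL : 2 * (k : ℝ) ≤ Ls := by linarith [hkx, hxLs8]
  -- (iii) `8 k³ Ls ≤ e^k`
  have hiii : 8 * (k : ℝ) ^ 3 * Ls ≤ Real.exp (k : ℝ) := by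
    have hc2' := hc2
    -- `log(8 Ls⁴) + 1 ≤ x ≤ k + 1`, i.e. `8 k³ Ls ≤ 8 Ls⁴ ≤ e^{x-1} ≤ e^k`
    have h84 : 8 * (k : ℝ) ^ 3 * Ls ≤ 8 * Ls ^ 4 := by
      have : (k : ℝ) ^ 3 ≤ Ls ^ 3 := pow_le_pow_left₀ (by positivity) hkLs 3
      calc 8 * (k : ℝ) ^ 3 * Ls ≤ 8 * Ls ^ 3 * Ls :=
            mul_le_mul_of_nonneg_right (mul_le_mul_of_nonneg_left this (by norm_num)) hLspos.le
        _ = 8 * Ls ^ 4 := by ring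
    have hlog8 : Real.log 8 = 3 * Real.log 2 := by
      rw [show (8 : ℝ) = 2 ^ 3 by norm_num, Real.log_pow]; push_cast; ring
    have hexpr : 8 * Ls ^ 4 = Real.exp (Real.log 8 + 4 * Real.log Ls) := by
      rw [Real.exp_add, Real.exp_log (by norm_num),
        show (4 : ℝ) * Real.log Ls = ((4 : ℕ) : ℝ) * Real.log Ls by norm_num,
        Real.exp_nat_mul, Real.exp_log hLspos]
    have hexponent : Real.log 8 + 4 * Real.log Ls ≤ x - 1 := by
      -- `(log 8 + 1 + 4 log Ls) · C₂ log Ls ≤ 8 C₂ (log Ls)² ≤ Ls`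
      have h1' : Real.log 8 + 1 + 4 * Real.log Ls ≤ 8 * Real.log Ls := by rw [hlog8]; linarith
      have h2' : (Real.log 8 + 1 + 4 * Real.log Ls) * (C₂ * Real.log Ls) ≤ Ls := by
        calc (Real.log 8 + 1 + 4 * Real.log Ls) * (C₂ * Real.log Ls)
            ≤ (8 * Real.log Ls) * (C₂ * Real.log Ls) :=
              mul_le_mul_of_nonneg_right h1' (by positivity)
          _ = 8 * C₂ * Real.log Ls ^ 2 := by ring
          _ ≤ Ls := hc2'
      rw [hx, le_sub_iff_add_le, le_div_iff₀ (by positivity)]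
      linarith
    calc 8 * (k : ℝ) ^ 3 * Ls ≤ 8 * Ls ^ 4 := h84
      _ = Real.exp (Real.log 8 + 4 * Real.log Ls) := hexpr
      _ ≤ Real.exp (x - 1) := Real.exp_le_exp.mpr hexponent
      _ ≤ Real.exp k := Real.exp_le_exp.mpr (by linarith)
  -- (ii) `4 k³ Ls² (4Ā²e²m)^k ≤ e^{Ls - 4k}`
  have hii : 4 * (k : ℝ) ^ 3 * Ls ^ 2 * (4 * Ab ^ 2 * Real.exp 2 * m) ^ k ≤
      Real.exp (Ls - 4 * (k : ℝ)) := by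
    obtain ⟨B, hB⟩ : ∃ B : ℝ, B = 4 * Ab ^ 2 * Real.exp 2 * m := ⟨_, rfl⟩
    rw [← hB]
    have he2 : 1 ≤ Real.exp 2 := by have := Real.add_one_le_exp (2:ℝ); linarith
    have hB1 : 1 ≤ B := by
      rw [hB]
      have : (1:ℝ) ≤ 4 * Ab ^ 2 := by linarith only [hAb2]
      calc (1:ℝ) = 1 * 1 * 1 := by ring
        _ ≤ 4 * Ab ^ 2 * Real.exp 2 * m := mul_le_mul (mul_le_mul this he2 zero_le_one (by positivity)) hm1 zero_le_one (by positivity)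
    have hBpos : 0 < B := by linarith
    -- `B = C₂ e^{-2} ℓ / 4`, so `log B ≤ log C₂ + log ℓ - 2 - log 4 ≤ log C₂ + log Ls`
    have hBeq : B = C₂ * ℓ / (4 * Real.exp 2) := by
      rw [hB, hC₂, hm]
      have : Real.exp 4 = Real.exp 2 * Real.exp 2 := by rw [← Real.exp_add]; norm_num
      rw [this]; field_simp; ring
    have hlogB : Real.log B ≤ Real.log C₂ + Real.log Ls := by
      have hlogℓ : Real.log ℓ ≤ Real.log Ls + Real.log 4 - 1 := by
        -- `ℓ ≤ log 4 + log Ls` (as `L ≤ 4 e^{Ls}`... from `L/4 ≤ Ls`? No: `ℓ = log L` and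
        -- `log Ls ≥ log (L/4) = ℓ - log 4`), then `log ℓ ≤ ℓ' - 1` at `ℓ' = ℓ/e`-type bound:
        -- use `log t ≤ t - 1` at `t = ℓ / Ls'`? Simplest: `log ℓ ≤ ℓ - 1`? too weak. We use
        -- `log ℓ ≤ log (log Ls + log 4) ≤ (log Ls + log 4) - 1`.
        have h1' : ℓ ≤ Real.log Ls + Real.log 4 := by rw [hlog4eq]; linarith only [hlogLsℓ4]
        calc Real.log ℓ ≤ Real.log (Real.log Ls + Real.log 4) := Real.log_le_log hℓpos h1'
          _ ≤ (Real.log Ls + Real.log 4) - 1 := Real.log_le_sub_one_of_pos (by linarith)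
      rw [hBeq, Real.log_div (by positivity) (by positivity), Real.log_mul hC₂pos.ne' hℓpos.ne',
        Real.log_mul (by norm_num) (Real.exp_pos 2).ne', Real.log_exp]
      linarith
    have hlogB0 : 0 ≤ Real.log B := Real.log_nonneg hB1
    -- `k log B ≤ x (log C₂ + log Ls) ≤ Ls (log C₂ + 1)/C₂ ≤ Ls/8`
    have hklogB : (k : ℝ) * Real.log B ≤ Ls / 8 := by
      have h1' : (k : ℝ) * Real.log B ≤ x * (Real.log C₂ + Real.log Ls) :=
        mul_le_mul hkx hlogB hlogB0 hxpos.le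
      have h2' : x * (Real.log C₂ + Real.log Ls) = Ls / C₂ * (Real.log C₂ / Real.log Ls + 1) := by
        rw [hx]; field_simp
      have hlogC₂0 : 0 ≤ Real.log C₂ := Real.log_nonneg (by linarith)
      have h3' : Real.log C₂ / Real.log Ls ≤ Real.log C₂ := div_le_self hlogC₂0 hlogLs1'
      have h4' : Real.log C₂ + 1 ≤ C₂ / 8 := log_add_one_le_div_eight (by linarith)
      have h5' : Ls / C₂ * (Real.log C₂ / Real.log Ls + 1) ≤ Ls / C₂ * (Real.log C₂ + 1) :=
        mul_le_mul_of_nonneg_left (by linarith) (by positivity)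
      have h6' : Ls / C₂ * (Real.log C₂ + 1) ≤ Ls / C₂ * (C₂ / 8) :=
        mul_le_mul_of_nonneg_left h4' (by positivity)
      have h7' : Ls / C₂ * (C₂ / 8) = Ls / 8 := by field_simp
      linarith
    -- `4 k³ Ls² ≤ 4 Ls⁵ = exp(log 4 + 5 log Ls)` and `B^k = exp(k log B)`
    have hpoly : 4 * (k : ℝ) ^ 3 * Ls ^ 2 ≤ Real.exp (Real.log 4 + 5 * Real.log Ls) := by
      have : (k : ℝ) ^ 3 ≤ Ls ^ 3 := pow_le_pow_left₀ (by positivity) hkLs 3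
      rw [Real.exp_add, Real.exp_log (by norm_num),
        show (5 : ℝ) * Real.log Ls = ((5 : ℕ) : ℝ) * Real.log Ls by norm_num,
        Real.exp_nat_mul, Real.exp_log hLspos]
      calc 4 * (k : ℝ) ^ 3 * Ls ^ 2 ≤ 4 * Ls ^ 3 * Ls ^ 2 :=
            mul_le_mul_of_nonneg_right (mul_le_mul_of_nonneg_left this (by norm_num)) (by positivity)
        _ = 4 * Ls ^ 5 := by ring
    have hBk : B ^ k = Real.exp ((k : ℝ) * Real.log B) := by
      rw [Real.exp_nat_mul, Real.exp_log hBpos]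
    have hc3' := hc3
    have h4k : 4 * (k : ℝ) ≤ Ls / 8 := by linarith [hkx, hxLs8]
    calc 4 * (k : ℝ) ^ 3 * Ls ^ 2 * B ^ k
        ≤ Real.exp (Real.log 4 + 5 * Real.log Ls) * Real.exp ((k : ℝ) * Real.log B) := by
          rw [hBk]; exact mul_le_mul_of_nonneg_right hpoly (Real.exp_pos _).le
      _ = Real.exp (Real.log 4 + 5 * Real.log Ls + (k : ℝ) * Real.log B) := by rw [← Real.exp_add]
      _ ≤ Real.exp (Ls - 4 * (k : ℝ)) := by
          rw [Real.exp_le_exp, hlog4eq]; linarith only [hc3', hklogB, h4k, hlog2', hLspos]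
  exact ⟨hi, hkL, hiii, hii, by linarith [hkx, hxLs8]⟩

end Summit.ABC.ABC.Theorems.SubPowerSY

end
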